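import Literature.Topology.FourManifolds.TrisectionsH23Regular
import Literature.Topology.FourManifolds.FlowFibreMorseIndex
import HarnessLib

/-!
# The Morse function of the handlebody `H₂₃`, III: indices of the lid critical points

Topic `Literature/Topology/FourManifolds`; infrastructure for the fact seat
`provefact-Literature.Topology.FourManifolds.exists_isBalancedGKTrisection` (Gay–Kirby 2016,
Thm. 4 via §4, Lemma 14), continuing `TrisectionsH23Regular.lean`.  Everything in this file is
**proved**; no named facts are introduced.

By `TrisectionsH23Regular.lean`, the critical points of the Morse function
`F_H = (1 - α(f - a) + β Ĝ)|H₂₃` of the handlebody `H₂₃ = X₂ ∩ X₃` that hit the level `f = a`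
and lie off the core zones are exactly the points `p` of the **flat lid** `{f = c}` lying over a
critical point `λ p` of the Heegaard function `g` on `H₁₂ ⊂ Y = f⁻¹(a)`.  This file computes
their Morse data: **such a critical point is nondegenerate, of index the Morse index of `g` at
`λ p`** (`BeltParams.nondegenerate_and_morseIndex_FH_eq_of_hit`).

The computation is Milnor's "`f|M^a`" calculus (Milnor 1963, §2–§3) for the level `{f = c}`
combined with the flow-fibre calculus of `FlowFibreMorseIndex.lean` (the function is
`Γ(φ̄, f)`, `φ̄` the lift of `g` along the gradient-like flow, `Γ(s, t) = 1 - α(t - a) + β(s - b)`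
with `∂₂Γ = 0` on the lid): read in the chart at `p = flow y₀ t₀` transported from the chart of
`X` at `y₀ = λ p` along the flow, the Hessian of `F_H` is the restriction of the chart Hessian
`B = ∂₂₂Γ ℓ ⊗ ℓ + ∂₁Γ Q` of `Γ(φ̄, f)` (`hessianInChart_transportedChart_comp₂_apply`) to the
tangent hyperplane `ker ℓ` of the lid, i.e. `β · Q|_{ker ℓ}`, and `Q|_{ker ℓ}` is congruent to
the Hessian of `φ̄|Y = g` at `y₀` (`LinearMap.BilinForm.sigNeg_restrict_ker_eq_of_radical`,
`RegularLevel.morseIndex_comp_incl_eq`):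

* `restrict_ker_hessianInChart_transportedChart_comp₂` — the generic statement: for `Γ` with
  `∂₂Γ = 0 < ∂₁Γ` at `(φ y₀, f z₀)` over a critical point `y₀` of the Morse function `φ`, the
  restriction of the chart Hessian of `Γ(φ̄, f)` at `z₀ = flow y₀ t₀` (transported chart) to
  `ker ℓ` is nondegenerate of index `index_φ y₀`;
* `hessianInChart_congr_of_eventuallyEq` — the chart Hessian depends only on the germ;
* `BeltParams.nondegenerate_and_morseIndex_FH_eq_of_hit` — the application to `F_H`.

## References

* D. Gay, R. Kirby, *Trisecting 4-manifolds*, Geom. Topol. 20 (2016), §4, Lemma 14. [GayKirby2016]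
* J. Milnor, *Morse theory* (1963), §2–§3. [Milnor1963]
* J. Milnor, *Lectures on the h-cobordism theorem* (1965), Thm. 3.4, Thm. 4.1. [MilnorHCobordism1965]
-/

open scoped Manifold ContDiff Topology
open Set Function Filter

noncomputable section

universe u

namespace Literature.Topology.FourManifolds

open Flow

/-! ### The restricted Hessian of `Γ(φ̄, f)` over a critical point of `φ` -/

section Generic

variable {m : ℕ} {M : Type u} [TopologicalSpace M] [T2Space M] [CompactSpace M]
  [ChartedSpace (EuclideanSpace ℝ (Fin (m + 1))) M] [IsManifold (𝓡 (m + 1)) ∞ M]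
  {f : M → ℝ} {ξ : Π x : M, TangentSpace (𝓡 (m + 1)) x} {a : ℝ}
  {hξ : ContMDiff (𝓡 (m + 1)) (𝓡 (m + 1)).tangent ∞ fun x => (⟨x, ξ x⟩ : TangentBundle (𝓡 (m + 1)) M)}
  {h : IsRegularLevel (𝓡 (m + 1)) f a}

omit [T2Space M] [CompactSpace M] [ChartedSpace (EuclideanSpace ℝ (Fin (m + 1))) M] [IsManifold (𝓡 (m + 1)) ∞ M] in
/-- **The chart Hessian depends only on the germ of the function** at the point. [folklore] -/
theorem hessianInChart_congr_of_eventuallyEq {F G : M → ℝ} {e : OpenPartialHomeomorph M (EuclideanSpace ℝ (Fin (m + 1)))}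
    {x : M} (hxe : x ∈ e.source) (hFG : F =ᶠ[𝓝 x] G) :
    hessianInChart (𝓡 (m + 1)) e F x = hessianInChart (𝓡 (m + 1)) e G x := by
  have hlim : Tendsto e.symm (𝓝 (e x)) (𝓝 x) := by
    have h := (e.continuousAt_symm (e.map_source hxe)).tendsto
    rwa [e.left_inv hxe] at h
  have hev : (F ∘ e.symm) =ᶠ[𝓝 (e x)] (G ∘ e.symm) := hlim.eventually hFG
  refine LinearMap.ext fun v => LinearMap.ext fun w => ?_
  rw [RegularLevel.hessianInChart_apply_eq, RegularLevel.hessianInChart_apply_eq, hev.fderiv.fderiv_eq]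

/-- `f` read in the transported chart is `(f ∘ flow_{t₀}) ∘ (chartAt y)⁻¹`. [folklore] -/
theorem comp_transportedChart_flow_symm (t₀ : ℝ) (y : M) :
    f ∘ (Diffeomorph.transportedChart (flowDiffeo hξ t₀) y).symm =
      (fun x => f (flow hξ x t₀)) ∘ (chartAt (EuclideanSpace ℝ (Fin (m + 1))) y).symm := by
  funext u; simp only [comp_apply, transportedChart_flow_symm_apply]

/-- The transported chart maps `flow y t₀` to `chartAt y y`. [folklore] -/
theorem transportedChart_flow_apply_flow (t₀ : ℝ) (y : M) :
    Diffeomorph.transportedChart (flowDiffeo hξ t₀) y (flow hξ y t₀) = chartAt (EuclideanSpace ℝ (Fin (m + 1))) y y := by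
  rw [transportedChart_flow_apply, flow_neg_flow]

variable {φ : RegularLevel h → ℝ} {Γ : ℝ × ℝ → ℝ}

/-- **The restricted Hessian of `Γ(φ̄, f)` over a critical point of `φ`.**  At `z₀ = flow y₀ t₀`
over a critical point `y₀` of the Morse function `φ`, with `∂₂Γ = 0 < ∂₁Γ` at `(φ y₀, f z₀)`:
the restriction of the chart Hessian of `Ψ = Γ(φ̄, f)` (transported chart at `z₀`) to the
hyperplane `ker ℓ`, `ℓ = D((f ∘ flow_{t₀}) ∘ (chartAt y₀)⁻¹)(chartAt y₀ y₀)` (the tangent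
hyperplane of the level of `f` through `z₀`), is nondegenerate, of negative index the Morse
index of `φ` at `y₀` (`Hess = ∂₂₂Γ ℓ ⊗ ℓ + ∂₁Γ Q` restricts to `∂₁Γ · Q|_{ker ℓ}`, and
`Q|_{ker ℓ} ≅ Hess(φ)_{y₀}`).  This is the Morse datum of `Ψ` restricted to a level of `f`.
[cite: Milnor1963, §2–§3] [cite: GayKirby2016, §4, Lemma 14] -/
theorem restrict_ker_hessianInChart_transportedChart_comp₂ (hgl : IsGradientLike (𝓡 (m + 1)) f ξ)
    (hfM : IsMorse (𝓡 (m + 1)) f) (hφM : IsMorse (𝓡 m) φ) (y₀ : RegularLevel h) (t₀ : ℝ)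
    (hy₀ : IsMCriticalPt (𝓡 m) φ y₀)
    (hΓ : ContDiffAt ℝ 2 Γ (φ y₀, f (flow hξ y₀.1 t₀)))
    (h2 : fderiv ℝ Γ (φ y₀, f (flow hξ y₀.1 t₀)) (0, 1) = 0)
    (h1 : 0 < fderiv ℝ Γ (φ y₀, f (flow hξ y₀.1 t₀)) (1, 0)) :
    ((hessianInChart (𝓡 (m + 1)) (Diffeomorph.transportedChart (flowDiffeo hξ t₀) y₀.1)
        (fun x => Γ (flowLift hξ h φ x, f x)) (flow hξ y₀.1 t₀)).restrict
        (LinearMap.ker ((fderiv ℝ ((fun x => f (flow hξ x t₀)) ∘ (chartAt (EuclideanSpace ℝ (Fin (m + 1))) y₀.1).symm)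
          (chartAt (EuclideanSpace ℝ (Fin (m + 1))) y₀.1 y₀.1) :
            EuclideanSpace ℝ (Fin (m + 1)) →L[ℝ] ℝ) : EuclideanSpace ℝ (Fin (m + 1)) →ₗ[ℝ] ℝ))).Nondegenerate ∧
    sigNeg ((hessianInChart (𝓡 (m + 1)) (Diffeomorph.transportedChart (flowDiffeo hξ t₀) y₀.1)
        (fun x => Γ (flowLift hξ h φ x, f x)) (flow hξ y₀.1 t₀)).restrict
        (LinearMap.ker ((fderiv ℝ ((fun x => f (flow hξ x t₀)) ∘ (chartAt (EuclideanSpace ℝ (Fin (m + 1))) y₀.1).symm)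
          (chartAt (EuclideanSpace ℝ (Fin (m + 1))) y₀.1 y₀.1) :
            EuclideanSpace ℝ (Fin (m + 1)) →L[ℝ] ℝ) : EuclideanSpace ℝ (Fin (m + 1)) →ₗ[ℝ] ℝ))).toQuadraticMap =
      morseIndex (𝓡 m) φ y₀ := by
  have hφ : ContMDiff (𝓡 m) 𝓘(ℝ, ℝ) ∞ φ := hφM.contMDiff
  set e' := chartAt (EuclideanSpace ℝ (Fin (m + 1))) y₀.1 with he'def
  set eT := Diffeomorph.transportedChart (flowDiffeo hξ t₀) y₀.1 with heTdef
  set z₀ := flow hξ y₀.1 t₀ with hz₀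
  set k : EuclideanSpace ℝ (Fin (m + 1)) → ℝ := (fun x => f (flow hξ x t₀)) ∘ e'.symm with hkdef
  set ℓ : EuclideanSpace ℝ (Fin (m + 1)) →ₗ[ℝ] ℝ :=
    ((fderiv ℝ k (e' y₀.1) : EuclideanSpace ℝ (Fin (m + 1)) →L[ℝ] ℝ) : EuclideanSpace ℝ (Fin (m + 1)) →ₗ[ℝ] ℝ) with hℓdef
  set ℓ₀ : EuclideanSpace ℝ (Fin (m + 1)) →ₗ[ℝ] ℝ :=
    ((fderiv ℝ (f ∘ e'.symm) (e' y₀.1) : EuclideanSpace ℝ (Fin (m + 1)) →L[ℝ] ℝ) :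
      EuclideanSpace ℝ (Fin (m + 1)) →ₗ[ℝ] ℝ) with hℓ₀def
  set Q : LinearMap.BilinForm ℝ (EuclideanSpace ℝ (Fin (m + 1))) :=
    hessianInChart (𝓡 (m + 1)) e' (flowLift hξ h φ) y₀.1 with hQdef
  set B : LinearMap.BilinForm ℝ (EuclideanSpace ℝ (Fin (m + 1))) :=
    hessianInChart (𝓡 (m + 1)) eT (fun x => Γ (flowLift hξ h φ x, f x)) z₀ with hBdef
  set vξ : EuclideanSpace ℝ (Fin (m + 1)) :=
    mfderiv (𝓡 (m + 1)) 𝓘(ℝ, EuclideanSpace ℝ (Fin (m + 1))) (e'.extend (𝓡 (m + 1))) y₀.1 (ξ y₀.1) with hξdef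
  have he' : e' ∈ IsManifold.maximalAtlas (𝓡 (m + 1)) ∞ M := IsManifold.chart_mem_maximalAtlas y₀.1
  have hye' : y₀.1 ∈ e'.source := mem_chart_source _ y₀.1
  have hy : Hits (flowθ hξ) f a y₀.1 := hits_of_level y₀
  have hz : Hits (flowθ hξ) f a z₀ := (isSmoothFlow_flow hξ).hits_apply_iff.2 hy
  have hcritFy : IsMCriticalPt (𝓡 (m + 1)) (flowLift hξ h φ) y₀.1 :=
    (isMCriticalPt_flowLift_iff_of_level hgl hfM hφ y₀).2 hy₀
  -- the Hessian formula
  have hB : ∀ v w, B v w = fderiv ℝ (fderiv ℝ Γ) (φ y₀, f z₀) (0, 1) (0, 1) * ℓ v * ℓ w +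
      fderiv ℝ Γ (φ y₀, f z₀) (1, 0) * Q v w := fun v w =>
    hessianInChart_transportedChart_comp₂_apply hgl hfM hφ y₀ t₀ hy₀ hΓ h2 v w
  -- properties of `Q`
  have hg2 : ContDiffAt ℝ 2 (flowLift hξ h φ ∘ e'.symm) (e' y₀.1) :=
    contDiffAt_flowLift_comp_symm hgl hfM hφ he' hye' hy
  have hQsymm : ∀ v w, Q v w = Q w v := fun v w => by
    simp only [hQdef, RegularLevel.hessianInChart_apply_eq]
    exact (hg2.isSymmSndFDerivAt (by simp)).eq v w
  have hQξ : ∀ w, Q vξ w = 0 ∧ Q w vξ = 0 := fun w =>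
    hessianInChart_flowLift_field hgl hfM hφ he' hye' hy hcritFy w
  -- `ℓ vξ > 0`, `ℓ₀ vξ ≠ 0`
  have hk2 : ContDiffAt ℝ 2 k (e' y₀.1) := contDiffAt_comp_flow_comp_symm hfM he' hye' t₀
  have hℓξ : ℓ vξ = mlineDeriv (𝓡 (m + 1)) f z₀ (ξ z₀) :=
    fderiv_comp_flow_comp_symm_apply_eq hfM he' hye' t₀ (hk2.differentiableAt (by norm_num))
  have hℓξpos : 0 < ℓ vξ := by rw [hℓξ]; exact mlineDeriv_pos_of_hits h hgl hz
  have hℓξne : ℓ vξ ≠ 0 := hℓξpos.ne'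
  have hℓ₀ξ : ℓ₀ vξ = mlineDeriv (𝓡 (m + 1)) f y₀.1 (ξ y₀.1) :=
    fderiv_comp_symm_apply_eq_mlineDeriv (hξ := hξ) hfM he' hye'
  have hℓ₀ξne : ℓ₀ vξ ≠ 0 := by rw [hℓ₀ξ]; exact (mlineDeriv_pos_of_hits h hgl hy).ne'
  -- the restriction to `ker ℓ`
  have hres : B.restrict (LinearMap.ker ℓ) = fderiv ℝ Γ (φ y₀, f z₀) (1, 0) • Q.restrict (LinearMap.ker ℓ) := by
    refine LinearMap.ext fun x => LinearMap.ext fun y => ?_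
    have hx : ℓ x = 0 := LinearMap.mem_ker.1 x.2
    simp only [LinearMap.BilinForm.restrict_apply, LinearMap.domRestrict_apply, LinearMap.smul_apply,
      hB, hx, zero_mul, mul_zero, zero_add, smul_eq_mul]
  set R : LinearMap.BilinForm ℝ (LinearMap.ker ℓ) := Q.restrict (LinearMap.ker ℓ) with hRdef
  have hF2 : ContMDiffAt (𝓡 (m + 1)) 𝓘(ℝ, ℝ) 2 (flowLift hξ h φ) y₀.1 :=
    (contMDiffAt_flowLift hgl hfM hφ hy).of_le (by norm_cast)
  have hidxR : sigNeg R.toQuadraticMap = morseIndex (𝓡 m) φ y₀ := by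
    rw [hRdef, LinearMap.BilinForm.sigNeg_restrict_ker_eq_of_radical Q hQξ hℓξne hℓ₀ξne,
      ← RegularLevel.morseIndex_comp_incl_eq y₀ hF2 hcritFy he' hye', flowLift_comp_incl hgl hfM φ]
  have hRnd : R.Nondegenerate := by
    rw [hRdef, LinearMap.BilinForm.nondegenerate_restrict_ker_iff_of_radical Q hQξ hℓξne hℓ₀ξne,
      ← RegularLevel.nondegenerate_mhessian_comp_incl_iff y₀ hF2 hcritFy he' hye',
      flowLift_comp_incl hgl hfM φ]
    exact hφM.nondegenerate hy₀
  constructor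
  · rw [hres, LinearMap.BilinForm.nondegenerate_smul_iff _ h1.ne']
    exact hRnd
  · rw [hres, LinearMap.BilinForm.sigNeg_smul_of_pos' R h1, hidxR]

end Generic

/-! ### The lid critical points of `F_H` -/

variable {X : Type u} [TopologicalSpace X] [T2Space X] [CompactSpace X]
  [ChartedSpace (EuclideanSpace ℝ (Fin 4)) X] [IsManifold (𝓡 4) ∞ X]

namespace BiCollar

namespace TriData

namespace TubeFrame

section Chart

variable {B : BiCollar X} {T : B.TriData} {ι : Type} [Fintype ι] (𝔉 : T.TubeFrame ι) {j : ι}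

/-! ### `f` read in Milnor's chart; the belt points -/

omit [T2Space X] [CompactSpace X] in
/-- The centred coordinates of the frame's `j`-th box through the chart inverse:
`coord_j (e⁻¹ z) = z - e c_j` (the frame-level instance of the translation identity of Milnor
boxes, cf. `MilnorBox.coord_symm_eq` of `TrisectionsSectorTwoHandles.lean`). [folklore] -/
theorem coord_symm_apply (j : ι) {z : EuclideanSpace ℝ (Fin 4)} (hz : z ∈ (𝔉.boxes.box j).chart.target) :
    (𝔉.boxes.box j).coord ((𝔉.boxes.box j).chart.symm z) = z - (𝔉.boxes.box j).chart (𝔉.boxes.cpt j) := by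
  simp only [MilnorBox.coord, OpenPartialHomeomorph.extend_coe, modelWithCornersSelf_coe, comp_apply, id_eq]
  rw [(𝔉.boxes.box j).chart.right_inv hz]

omit [T2Space X] [CompactSpace X] in
/-- The centred coordinates of a point of the `j`-th chart domain: `coord_j x = e x - e c_j`
(frame-level instance of `MilnorBox.coord_eq`). [folklore] -/
theorem coord_eq_sub {x : X} (hx : x ∈ (𝔉.boxes.box j).chart.source) :
    (𝔉.boxes.box j).coord x = (𝔉.boxes.box j).chart x - (𝔉.boxes.box j).chart (𝔉.boxes.cpt j) := by
  rw [← 𝔉.coord_symm_apply j ((𝔉.boxes.box j).chart.map_source hx), (𝔉.boxes.box j).chart.left_inv hx]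

omit [T2Space X] [CompactSpace X] in
/-- **`f` read in Milnor's chart**: `f (e⁻¹ z) = a + η₂ - A(z - e c_j) + B(z - e c_j)`. [cite: MilnorHCobordism1965, Def. 3.1] -/
theorem f_symm_apply {z : EuclideanSpace ℝ (Fin 4)} (hz : z ∈ (𝔉.boxes.box j).chart.target) :
    B.f ((𝔉.boxes.box j).chart.symm z) = B.a + 𝔉.η₂ - BeltModel.qA (z - (𝔉.boxes.box j).chart (𝔉.boxes.cpt j))
      + BeltModel.qB (z - (𝔉.boxes.box j).chart (𝔉.boxes.cpt j)) := by
  rw [𝔉.boxes.apply_eq ((𝔉.boxes.box j).chart.map_target hz), 𝔉.A_eq_qA, 𝔉.B_eq_qB, 𝔉.coord_symm_apply j hz]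

omit [T2Space X] [CompactSpace X] in
/-- **The derivative of `f` in Milnor's chart**: `D(f ∘ e⁻¹)(z) v = 2⟨y⃗(u), y⃗(v)⟩ - 2⟨x⃗(u), x⃗(v)⟩`,
`u = z - e c_j`. [cite: MilnorHCobordism1965, Def. 3.1] -/
theorem fderiv_f_symm_apply {z : EuclideanSpace ℝ (Fin 4)} (hz : z ∈ (𝔉.boxes.box j).chart.target)
    (v : EuclideanSpace ℝ (Fin 4)) :
    fderiv ℝ (B.f ∘ (𝔉.boxes.box j).chart.symm) z v =
      2 * BeltModel.ydot (z - (𝔉.boxes.box j).chart (𝔉.boxes.cpt j)) v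
        - 2 * BeltModel.xdot (z - (𝔉.boxes.box j).chart (𝔉.boxes.cpt j)) v := by
  set zc := (𝔉.boxes.box j).chart (𝔉.boxes.cpt j) with hzc
  have hev : (B.f ∘ (𝔉.boxes.box j).chart.symm) =ᶠ[𝓝 z]
      fun y => B.a + 𝔉.η₂ - BeltModel.qA (y - zc) + BeltModel.qB (y - zc) := by
    filter_upwards [(𝔉.boxes.box j).chart.open_target.mem_nhds hz] with y hy
    exact 𝔉.f_symm_apply hy
  rw [hev.fderiv_eq]
  have h1 : HasFDerivAt (fun y : EuclideanSpace ℝ (Fin 4) => y - zc)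
      (ContinuousLinearMap.id ℝ (EuclideanSpace ℝ (Fin 4))) z := (hasFDerivAt_id z).sub_const zc
  have hA := (BeltModel.hasFDerivAt_qA (z - zc)).comp z h1
  have hB := (BeltModel.hasFDerivAt_qB (z - zc)).comp z h1
  have h : HasFDerivAt (fun y : EuclideanSpace ℝ (Fin 4) => B.a + 𝔉.η₂ - BeltModel.qA (y - zc) + BeltModel.qB (y - zc))
      ((0 : EuclideanSpace ℝ (Fin 4) →L[ℝ] ℝ)
        - ((2 * (z - zc) 0) • BeltModel.P 0 + (2 * (z - zc) 1) • BeltModel.P 1).comp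
            (ContinuousLinearMap.id ℝ (EuclideanSpace ℝ (Fin 4)))
        + ((2 * (z - zc) 2) • BeltModel.P 2 + (2 * (z - zc) 3) • BeltModel.P 3).comp
            (ContinuousLinearMap.id ℝ (EuclideanSpace ℝ (Fin 4)))) z :=
    ((hasFDerivAt_const _ z).sub hA).add hB
  rw [h.fderiv]
  simp only [_root_.add_apply, _root_.sub_apply, _root_.zero_apply, ContinuousLinearMap.comp_apply,
    ContinuousLinearMap.id_apply, _root_.smul_apply, BeltModel.P_apply, smul_eq_mul, BeltModel.xdot_apply,
    BeltModel.ydot_apply]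
  ring

/-- The Milnor coordinates `(0, 0, s, 0)` of the belt points (`s = ±ν`). [folklore] -/
def beltVec (s : ℝ) : EuclideanSpace ℝ (Fin 4) := s • TubeModel.E4 2

/-- Coordinates of `beltVec s`. [folklore] -/
@[simp] theorem beltVec_apply (s : ℝ) (i : Fin 4) : beltVec s i = if i = 2 then s else 0 := by
  simp only [beltVec, PiLp.smul_apply, TubeModel.E4_apply, smul_eq_mul, mul_ite, mul_one, mul_zero]

/-- **The belt point** `q_j(s) = e⁻¹ (e c_j + (0, 0, s, 0))`. [cite: GayKirby2016, §4, Lemma 14] -/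
def beltPt (j : ι) (s : ℝ) : X := (𝔉.boxes.box j).chart.symm ((𝔉.boxes.box j).chart (𝔉.boxes.cpt j) + beltVec s)

omit [T2Space X] [CompactSpace X] in
/-- For `s² ≤ η₂`, the coordinate point of the belt point lies in the chart target. [folklore] -/
theorem beltVec_mem_target {s : ℝ} (hs : s ^ 2 ≤ 𝔉.η₂) :
    (𝔉.boxes.box j).chart (𝔉.boxes.cpt j) + beltVec s ∈ (𝔉.boxes.box j).chart.target := by
  have h := (𝔉.boxes.box j).add_mem_target (J := 𝓡 4) (v := beltVec s) ?_ ?_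
  · simpa using h
  · rw [𝔉.boxes.k_eq j, sqSumLT_two_apply]
    have h0 : beltVec s 0 = 0 := by simp
    have h1 : beltVec s 1 = 0 := by simp
    rw [h0, h1]; nlinarith [(𝔉.boxes.box j).eps_pos]
  · rw [𝔉.boxes.k_eq j, sqSumGE_two_apply]
    have h2 : beltVec s 2 = s := by simp
    have h3 : beltVec s 3 = 0 := by simp
    rw [h2, h3]; nlinarith [𝔉.boxes.eta_lt j]

omit [T2Space X] [CompactSpace X] in
/-- The belt point lies in the chart domain. [folklore] -/
theorem beltPt_mem_source {s : ℝ} (hs : s ^ 2 ≤ 𝔉.η₂) : 𝔉.beltPt j s ∈ (𝔉.boxes.box j).chart.source :=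
  (𝔉.boxes.box j).chart.map_target (𝔉.beltVec_mem_target hs)

omit [T2Space X] [CompactSpace X] in
/-- The Milnor coordinates of the belt point. [folklore] -/
theorem coord_beltPt {s : ℝ} (hs : s ^ 2 ≤ 𝔉.η₂) :
    (𝔉.boxes.box j).coord (𝔉.beltPt j s) = beltVec s := by
  rw [beltPt, 𝔉.coord_symm_apply j (𝔉.beltVec_mem_target hs), add_sub_cancel_left]

omit [T2Space X] [CompactSpace X] in
/-- The height of the belt point: `f = a + η₂ + s²`. [folklore] -/
theorem f_beltPt {s : ℝ} (hs : s ^ 2 ≤ 𝔉.η₂) : B.f (𝔉.beltPt j s) = B.a + 𝔉.η₂ + s ^ 2 := by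
  rw [𝔉.boxes.apply_eq (𝔉.beltPt_mem_source hs), 𝔉.A_eq_qA, 𝔉.B_eq_qB, 𝔉.coord_beltPt hs,
    BeltModel.qA_apply, BeltModel.qB_apply]
  simp

end Chart

namespace BeltParams

variable {B : BiCollar X} {T : B.TriData} {ι : Type} [Fintype ι] {𝔉 : T.TubeFrame ι} (𝔓 : 𝔉.BeltParams)
  (hc2 : B.a + B.U.δ + 2 * T.ε ≤ T.c)

/-- The two-variable function of the lid: `Γ(s, t) = 1 - α(t - a) + β(s - b) = Γ_F(s, t) - βb`. [folklore] -/
def ΓL (q : ℝ × ℝ) : ℝ := 𝔓.ΓF q - 𝔓.β * B.b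

omit [T2Space X] [CompactSpace X] in
/-- The partial derivatives of `Γ_L`: `∂₁ = β`, `∂₂ = -α'(t - a)`. [folklore] -/
theorem fderiv_ΓL (q : ℝ × ℝ) :
    fderiv ℝ 𝔓.ΓL q (1, 0) = 𝔓.β ∧ fderiv ℝ 𝔓.ΓL q (0, 1) = -deriv T.alpha (q.2 - B.a) := by
  have h : fderiv ℝ 𝔓.ΓL q = fderiv ℝ 𝔓.ΓF q := by
    show fderiv ℝ (fun q => 𝔓.ΓF q - 𝔓.β * B.b) q = _
    exact fderiv_sub_const _
  obtain ⟨h1, h2⟩ := 𝔓.partials_ΓF q.1 q.2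
  exact ⟨by rw [h]; exact h1, by rw [h]; exact h2⟩

omit [T2Space X] [CompactSpace X] in
/-- `Γ_L` is smooth. [folklore] -/
theorem contDiff_ΓL : ContDiff ℝ ∞ 𝔓.ΓL :=
  ((contDiff_const.sub (T.contDiff_alpha.comp (contDiff_snd.sub contDiff_const))).add
    (contDiff_const.mul contDiff_fst)).sub contDiff_const

/-- Near a hitting point off the zones, `F = Γ_L(φ̄, f)` with `φ̄` the lift of `g`. [cite: GayKirby2016, §4, Lemma 14] -/
theorem Famb_eventuallyEq_ΓL {p : X} (hH : p ∈ T.H₂₃) (hp₁ : p ∉ T.X₁) (hz : ∀ j, p ∉ 𝔓.zone j)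
    (hh : B.Hit p) :
    𝔓.Famb =ᶠ[𝓝 p] fun x => 𝔓.ΓL (flowLift B.U.contMDiff B.hf B.g x, B.f x) := by
  filter_upwards [𝔓.Famb_eventuallyEq_Flin hH hp₁ hz, B.gFun_eventuallyEq T.Fr hh] with x hx hG
  rw [hx, Flin, hG]
  simp only [ΓL, ΓF]
  ring

include hc2 in
/-- **The lid critical points of `F_H` are nondegenerate, of index the Morse index of `g` at the
landing point.**  For a hitting point `p ∈ H₂₃` off the core zones which is critical for `F_H`
(so `f p = c`, `w p ≥ ε` and `λ p` is critical for `g`, `TrisectionsH23Regular.lean`), with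
`g` a Morse function: the Hessian of `F_H` at `p` is nondegenerate and
`index_{F_H}(p) = index_g(λ p)`. [cite: GayKirby2016, §4, Lemma 14] [cite: Milnor1963, §2–§3] -/
theorem nondegenerate_and_morseIndex_FH_eq_of_hit (hgM : IsMorse (𝓡 3) B.g) {p : T.H₂₃}
    (hps : p.1 ∉ B.surface) (hh : B.Hit p.1) (hz : ∀ j, p.1 ∉ 𝔓.zone j)
    (hcrit : letI := (T.bsliceAtlas hc2 𝔉.two_mul_ε_le 𝔉.linkCondition).chartedSpace
      IsMCriticalPt (𝓡∂ 3) 𝔓.FH p) :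
    letI := (T.bsliceAtlas hc2 𝔉.two_mul_ε_le 𝔉.linkCondition).chartedSpace
    (mhessian (𝓡∂ 3) 𝔓.FH p).Nondegenerate ∧
      morseIndex (𝓡∂ 3) 𝔓.FH p = morseIndex (𝓡 3) B.g (B.lamLift p.1) := by
  letI := (T.bsliceAtlas hc2 𝔉.two_mul_ε_le 𝔉.linkCondition).chartedSpace
  set Φ := T.bsliceAtlas hc2 𝔉.two_mul_ε_le 𝔉.linkCondition with hΦ
  obtain ⟨hcg, -⟩ := 𝔓.isMCriticalPt_g_of_isMCriticalPt_FH hc2 hps hh hz hcrit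
  obtain ⟨hfc, hwε⟩ := 𝔓.f_eq_c_of_isMCriticalPt_FH hc2 hps hh hz hcrit
  have hp₁ : p.1 ∉ T.X₁ := fun h1 => hps (by rw [← T.H₂₃_inter_X₁ hc2]; exact ⟨p.2, h1⟩)
  have h0 : T.M p.1 = 0 := T.M_eq_zero_of_mem_H₂₃ p.2 hh
  have hint : (𝓡∂ 3).IsInteriorPoint p := by
    rw [ModelWithCorners.isInteriorPoint_iff_not_isBoundaryPoint,
      T.isBoundaryPoint_iff_mem_surface hc2 𝔉.two_mul_ε_le 𝔉.linkCondition p]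
    exact hps
  -- the level point and the flow time
  set y₀ : B.Y := B.lamLift p.1 with hy₀
  have hy₀v : y₀.1 = levelProj B.U.contMDiff B.f B.a p.1 := congrArg Subtype.val (B.lamLift_eq_of_hit hh)
  obtain ⟨t₀, ht₀⟩ : ∃ t, flow B.U.contMDiff y₀.1 t = p.1 := by
    rw [hy₀v]; exact mem_range_flow_levelProj B.U.contMDiff B.a p.1
  -- the transported chart
  set eT := Diffeomorph.transportedChart (flowDiffeo B.U.contMDiff t₀) y₀.1 with heTdef
  have heT : eT ∈ IsManifold.maximalAtlas (𝓡 4) ∞ X :=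
    Diffeomorph.transportedChart_mem_maximalAtlas (flowDiffeo B.U.contMDiff t₀) y₀.1
  have hpe : p.1 ∈ eT.source := by
    rw [← ht₀]; exact Diffeomorph.mem_transportedChart_source (flowDiffeo B.U.contMDiff t₀) y₀.1
  -- the local level function `ψ = strFun` and the dictionary
  have hψ := T.contMDiff_strFun hh h0
  have hψc := T.not_isMCriticalPt_strFun hh h0
  have hO := T.isOpen_strDom hh h0
  have hpO := T.mem_strDom hh h0 hp₁
  have hS : ∀ q ∈ T.strDom hh h0, q ∈ T.H₂₃ ↔ T.strFun hh h0 q = T.strFun hh h0 p.1 := fun q hq =>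
    T.mem_H₂₃_iff_of_mem_strDom hh h0 hq
  have hF : ContMDiffAt (𝓡 4) 𝓘(ℝ, ℝ) 2 𝔓.Famb p.1 := (𝔓.contMDiffAt_Famb_of_mem_H₂₃ hc2 p.2).of_le (by norm_cast)
  have hFcrit : IsMCriticalPt (𝓡 4) 𝔓.Famb p.1 := 𝔓.isMCriticalPt_Famb p.2 hp₁ hz hh hcg hfc
  have hidx := Φ.morseIndex_comp_val_eq_of_localLevel hψ hψc hO hpO hS hint hF hFcrit heT hpe
  have hnd := Φ.nondegenerate_mhessian_comp_val_iff_of_localLevel hψ hψc hO hpO hS hint hF hFcrit heT hpe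
  -- `ker D(ψ ∘ eT⁻¹)(eT p) = ker D(f ∘ eT⁻¹)(eT p)` (flat lid: `σ' = 1`)
  have hlim : Tendsto eT.symm (𝓝 (eT p.1)) (𝓝 p.1) := by
    have h := (eT.continuousAt_symm (eT.map_source hpe)).tendsto
    rwa [eT.left_inv hpe] at h
  have hevM : (T.strFun hh h0 ∘ eT.symm) =ᶠ[𝓝 (eT p.1)] (T.M ∘ eT.symm) :=
    hlim.eventually (T.strFun_eventuallyEq hh h0)
  have hσ1 : creaseStep (T.w p.1 / T.ε) = 1 :=
    creaseStep_of_one_le (by rw [le_div_iff₀ T.ε_pos]; linarith)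
  have hker : fderiv ℝ (T.strFun hh h0 ∘ eT.symm) (eT p.1) = fderiv ℝ (B.f ∘ eT.symm) (eT p.1) := by
    rw [hevM.fderiv_eq]
    ext v
    rw [T.fderiv_M_comp_symm_apply heT hpe hh v, hσ1]
    ring
  -- the Hessian of `F` is that of `Γ_L(φ̄, f)` (germs)
  have hgerm : hessianInChart (𝓡 4) eT 𝔓.Famb p.1 =
      hessianInChart (𝓡 4) eT (fun x => 𝔓.ΓL (flowLift B.U.contMDiff B.hf B.g x, B.f x)) p.1 :=
    hessianInChart_congr_of_eventuallyEq hpe (𝔓.Famb_eventuallyEq_ΓL p.2 hp₁ hz hh)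
  rw [hidx, hnd, hker, hgerm]
  -- move to the point `flow y₀ t₀` and apply the generic computation
  rw [← ht₀, comp_transportedChart_flow_symm, transportedChart_flow_apply_flow]
  have hfz : B.f (flow B.U.contMDiff y₀.1 t₀) = T.c := by rw [ht₀]; exact hfc
  have hΓ : ContDiffAt ℝ 2 𝔓.ΓL (B.g y₀, B.f (flow B.U.contMDiff y₀.1 t₀)) :=
    (𝔓.contDiff_ΓL.of_le (by norm_cast)).contDiffAt
  obtain ⟨h1, h2⟩ := 𝔓.fderiv_ΓL (B.g y₀, B.f (flow B.U.contMDiff y₀.1 t₀))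
  have h2' : fderiv ℝ 𝔓.ΓL (B.g y₀, B.f (flow B.U.contMDiff y₀.1 t₀)) (0, 1) = 0 := by
    rw [h2, hfz, neg_eq_zero]
    apply T.deriv_alpha_of_ge
    have := T.ε_pos
    unfold αS ασ; linarith
  have h1' : 0 < fderiv ℝ 𝔓.ΓL (B.g y₀, B.f (flow B.U.contMDiff y₀.1 t₀)) (1, 0) := by
    rw [h1]; exact 𝔓.β_pos
  have key := restrict_ker_hessianInChart_transportedChart_comp₂ (hξ := B.U.contMDiff) (h := B.hf)
    T.Fr.isGradientLike T.Fr.isMorse hgM y₀ t₀ hcg hΓ h2' h1'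
  exact ⟨key.1, key.2⟩

/-! ### The zones: `H₂₃ ∩ zone_j = {f = c} ∩ zone_j`, off `X₁` and off the surface -/

section Zone

variable {j : ι}

/-- A zone point lies outside `X₁` (`f > c - m₁ > a` there, while `s ≤ 0` on `X₁`). [folklore] -/
theorem not_mem_X₁_of_mem_zone {x : X} (hx : x ∈ 𝔓.zone j) : x ∉ T.X₁ := fun h1 => by
  have hs := T.D.sFun_nonpos_of_mem_sector h1
  have hf := (𝔓.f_bounds_of_mem_zone hx).1
  have hsdef : B.sFun x = B.f x - B.a := rfl
  have := 𝔉.c_eq; have := 𝔓.m₁_le_ν; have := 𝔉.η₂_pos; have := 𝔉.ν_pos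
  nlinarith

/-- A zone point lies off the central surface (the surface lies in the bi-collar box, which misses the zones). [folklore] -/
theorem not_mem_surface_of_mem_zone {x : X} (hx : x ∈ 𝔓.zone j) : x ∉ B.surface := fun hs =>
  𝔓.not_mem_zone_of_mem_box (B.mem_box_of_mem_surface T.D.εw_pos hs) j hx

include hc2 in
/-- **A zone point on the lid lies in `H₂₃`** (a hitting one has `G ≤ -m₀ < -ε`, so `M = G + σ_ε(-G) = 0`;
a non-hitting one is a sheet top). [cite: GayKirby2016, §4, Lemma 14] -/
theorem mem_H₂₃_of_mem_zone_of_f_eq {x : X} (hx : x ∈ 𝔓.zone j) (hfc : B.f x = T.c) : x ∈ T.H₂₃ := by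
  rw [T.mem_H₂₃_iff hc2 𝔉.two_mul_ε_le 𝔉.linkCondition]
  have hx₁ := 𝔓.not_mem_X₁_of_mem_zone hx
  by_cases hh : B.Hit x
  · refine Or.inr (Or.inl ⟨hx₁, hh, ?_⟩)
    obtain ⟨hf₁, hf₂⟩ := 𝔓.band_of_mem_zone hx
    have hG := 𝔉.gFun_le_of_P_lt hx.1 (𝔓.P_lt_of_mem_zone hx) hf₁ hf₂ hh
    have hM : T.M x = B.gFun x + creaseσ T.ε (B.f x - T.c - B.gFun x) := rfl
    rw [hM, hfc, sub_self, zero_sub, creaseσ_of_le T.ε_pos (by linarith [𝔉.lt_m₀, T.ε_pos])]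
    ring
  · exact Or.inr (Or.inr ⟨hx₁, hh, hfc⟩)

include hc2 in
/-- **On a zone, `H₂₃` is the lid `{f = c}`.** [cite: GayKirby2016, §4, Lemma 14] -/
theorem mem_H₂₃_iff_of_mem_zone {x : X} (hx : x ∈ 𝔓.zone j) : x ∈ T.H₂₃ ↔ B.f x = T.c :=
  ⟨fun hH => 𝔓.f_eq_c_of_mem_H₂₃_of_mem_zone hH (𝔓.not_mem_X₁_of_mem_zone hx) hx,
    fun h => 𝔓.mem_H₂₃_of_mem_zone_of_f_eq hc2 hx h⟩

/-- Near the chart image of a zone point above `B = ν²/2`, `F ∘ e⁻¹ = C + belt (· - e c_j)`. [cite: GayKirby2016, §4, Lemma 14] -/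
theorem Famb_symm_eventuallyEq {z : EuclideanSpace ℝ (Fin 4)} (hz : z ∈ (𝔉.boxes.box j).chart.target)
    (hzone : (𝔉.boxes.box j).chart.symm z ∈ 𝔓.zone j)
    (hB : 𝔉.ν ^ 2 / 2 < BeltModel.qB (z - (𝔉.boxes.box j).chart (𝔉.boxes.cpt j))) :
    (𝔓.Famb ∘ (𝔉.boxes.box j).chart.symm) =ᶠ[𝓝 z] fun y => 𝔓.chartConst +
      BeltModel.belt (𝔓.β * 𝔉.kg) 𝔉.εT (𝔉.κT / 𝔉.η₂) 𝔓.τp 𝔓.rhoHat 𝔓.chi2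
        (y - (𝔉.boxes.box j).chart (𝔉.boxes.cpt j)) := by
  set e := (𝔉.boxes.box j).chart with hedef
  set zc := e (𝔉.boxes.cpt j) with hzc
  have h1 : ∀ᶠ y in 𝓝 z, y ∈ e.target := e.open_target.mem_nhds hz
  have h2 : ∀ᶠ y in 𝓝 z, e.symm y ∈ 𝔓.zone j :=
    (e.continuousAt_symm hz).preimage_mem_nhds ((𝔓.isOpen_zone j).mem_nhds hzone)
  have h3 : ∀ᶠ y in 𝓝 z, 𝔉.ν ^ 2 / 2 < BeltModel.qB (y - zc) := by
    have hc : Continuous fun y : EuclideanSpace ℝ (Fin 4) => BeltModel.qB (y - zc) :=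
      BeltModel.contDiff_qB.continuous.comp (continuous_id.sub continuous_const)
    exact (isOpen_lt continuous_const hc).mem_nhds hB
  filter_upwards [h1, h2, h3] with y hy1 hy2 hy3
  exact 𝔓.Famb_comp_symm_apply hy1 hy2 hy3.le

/-- **The derivative of `F` in Milnor's chart on the zone** (above `B = ν²/2`): the derivative
`dbelt` of the belt function at `u = z - e c_j`. [cite: GayKirby2016, §4, Lemma 14] -/
theorem fderiv_Famb_symm_apply {z : EuclideanSpace ℝ (Fin 4)} (hz : z ∈ (𝔉.boxes.box j).chart.target)
    (hzone : (𝔉.boxes.box j).chart.symm z ∈ 𝔓.zone j)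
    (hB : 𝔉.ν ^ 2 / 2 < BeltModel.qB (z - (𝔉.boxes.box j).chart (𝔉.boxes.cpt j))) (v : EuclideanSpace ℝ (Fin 4)) :
    fderiv ℝ (𝔓.Famb ∘ (𝔉.boxes.box j).chart.symm) z v =
      BeltModel.dbelt (𝔓.β * 𝔉.kg) 𝔉.εT (𝔉.κT / 𝔉.η₂) 𝔓.τp 𝔓.rhoHat 𝔓.chi2
        (z - (𝔉.boxes.box j).chart (𝔉.boxes.cpt j)) v := by
  rw [(𝔓.Famb_symm_eventuallyEq hz hzone hB).fderiv_eq, fderiv_const_add,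
    fderiv_comp_sub ((𝔉.boxes.box j).chart (𝔉.boxes.cpt j))]
  have hBne : BeltModel.qB (z - (𝔉.boxes.box j).chart (𝔉.boxes.cpt j)) ≠ 0 := by
    have := 𝔉.ν_pos; intro h; rw [h] at hB; nlinarith
  exact BeltModel.fderiv_belt_apply (𝔓.contDiff_rhoHat.differentiable (by simp))
    (𝔓.contDiff_chi2.differentiable (by simp)) hBne v

/-- **The second derivative of `F` in Milnor's chart at a zone point with `x⃗ = 0`, `u₃ = 0`**:
`D²(F ∘ e⁻¹)(z)(v, w) = 2 K k₁ u₂² (v₀w₀ + v₁w₁) + τ' u₂ (√B)⁻³ v₃ w₃`, `u = z - e c_j`,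
`K = β k_g`, `k₁ = κ_T/η₂`. [cite: GayKirby2016, §4, Lemma 14] -/
theorem fderiv_fderiv_Famb_symm_apply {z : EuclideanSpace ℝ (Fin 4)} (hz : z ∈ (𝔉.boxes.box j).chart.target)
    (hzone : (𝔉.boxes.box j).chart.symm z ∈ 𝔓.zone j)
    (hB : 𝔉.ν ^ 2 / 2 < BeltModel.qB (z - (𝔉.boxes.box j).chart (𝔉.boxes.cpt j)))
    (h0 : (z - (𝔉.boxes.box j).chart (𝔉.boxes.cpt j)) 0 = 0) (h1 : (z - (𝔉.boxes.box j).chart (𝔉.boxes.cpt j)) 1 = 0)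
    (h3 : (z - (𝔉.boxes.box j).chart (𝔉.boxes.cpt j)) 3 = 0) (v w : EuclideanSpace ℝ (Fin 4)) :
    fderiv ℝ (fderiv ℝ (𝔓.Famb ∘ (𝔉.boxes.box j).chart.symm)) z v w =
      2 * (𝔓.β * 𝔉.kg) * (𝔉.κT / 𝔉.η₂) * (z - (𝔉.boxes.box j).chart (𝔉.boxes.cpt j)) 2 ^ 2 * (v 0 * w 0 + v 1 * w 1)
        + 𝔓.τp * (z - (𝔉.boxes.box j).chart (𝔉.boxes.cpt j)) 2 *
          (Real.sqrt (BeltModel.qB (z - (𝔉.boxes.box j).chart (𝔉.boxes.cpt j))))⁻¹ ^ 3 * (v 3 * w 3) := by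
  set zc := (𝔉.boxes.box j).chart (𝔉.boxes.cpt j) with hzc
  have hBne : BeltModel.qB (z - zc) ≠ 0 := by
    have := 𝔉.ν_pos; intro h; rw [h] at hB; nlinarith
  rw [((𝔓.Famb_symm_eventuallyEq hz hzone hB).fderiv).fderiv_eq]
  have hfd : fderiv ℝ (fun y : EuclideanSpace ℝ (Fin 4) => 𝔓.chartConst +
      BeltModel.belt (𝔓.β * 𝔉.kg) 𝔉.εT (𝔉.κT / 𝔉.η₂) 𝔓.τp 𝔓.rhoHat 𝔓.chi2 (y - zc)) =
      fun y => fderiv ℝ (BeltModel.belt (𝔓.β * 𝔉.kg) 𝔉.εT (𝔉.κT / 𝔉.η₂) 𝔓.τp 𝔓.rhoHat 𝔓.chi2) (y - zc) := by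
    funext y
    rw [fderiv_const_add, fderiv_comp_sub zc]
  rw [hfd, fderiv_comp_sub zc]
  have hr : 0 < min 𝔓.r₀ 𝔓.r₂ := lt_min 𝔓.r₀_pos 𝔓.r₂_pos
  exact BeltModel.fderiv_fderiv_belt_apply hr (fun A hA => 𝔓.rhoHat_of_le (hA.le.trans (min_le_left _ _)))
    (fun A hA => 𝔓.chi2_of_le (hA.le.trans (min_le_right _ _))) h0 h1 h3 hBne v w

/-! ### The hypotheses of the belt model -/

omit [T2Space X] [CompactSpace X] in
/-- `A ρ̂(A) = χ(A)`. [folklore] -/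
theorem mul_rhoHat (A : ℝ) : A * 𝔓.rhoHat A = 𝔓.chi A := by
  rcases le_or_gt A 𝔓.r₀ with h | h
  · rw [𝔓.rhoHat_of_le h, 𝔓.chi_of_le h, mul_zero]
  · have hA : A ≠ 0 := by linarith [𝔓.r₀_pos]
    rw [rhoHat, mul_div_cancel₀ _ hA]

omit [T2Space X] [CompactSpace X] in
/-- `ρ̂ + A ρ̂' = χ'` (the derivative of `A ρ̂(A) = χ(A)`). [folklore] -/
theorem rhoHat_add_mul_deriv (A : ℝ) : 𝔓.rhoHat A + A * deriv 𝔓.rhoHat A = deriv 𝔓.chi A := by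
  have hρ : HasDerivAt 𝔓.rhoHat (deriv 𝔓.rhoHat A) A :=
    ((𝔓.contDiff_rhoHat.differentiable (by simp)) A).hasDerivAt
  have h : HasDerivAt 𝔓.chi (1 * 𝔓.rhoHat A + id A * deriv 𝔓.rhoHat A) A := by
    have h' := (hasDerivAt_id A).mul hρ
    have hfun : (id * 𝔓.rhoHat : ℝ → ℝ) = 𝔓.chi := funext fun A => 𝔓.mul_rhoHat A
    rwa [hfun] at h'
  rw [h.deriv]
  simp

omit [T2Space X] [CompactSpace X] in
/-- `0 ≤ ρ̂ + A ρ̂' ≤ L`. [folklore] -/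
theorem rhoHat_add_mul_deriv_mem (A : ℝ) : 0 ≤ 𝔓.rhoHat A + A * deriv 𝔓.rhoHat A ∧
    𝔓.rhoHat A + A * deriv 𝔓.rhoHat A ≤ 𝔓.L := by
  rw [𝔓.rhoHat_add_mul_deriv]
  exact ⟨𝔓.monotone_chi.deriv_nonneg, 𝔓.deriv_chi_le A⟩

omit [T2Space X] [CompactSpace X] in
/-- `|χ₂'| ≤ L₂`. [folklore] -/
theorem abs_deriv_chi2_le' (A : ℝ) : |deriv 𝔓.chi2 A| ≤ 𝔓.L₂ := 𝔓.abs_deriv_chi2_le A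

omit [T2Space X] [CompactSpace X] in
/-- The smallness condition of the belt model: `K ε_T L + τ' L₂ < K k₁ ν²`, `K = β k_g`. [folklore] -/
theorem belt_small : 𝔓.β * 𝔉.kg * 𝔉.εT * 𝔓.L + 𝔓.τp * 𝔓.L₂ < 𝔓.β * 𝔉.kg * (𝔉.κT / 𝔉.η₂) * 𝔉.ν ^ 2 := by
  have h := mul_lt_mul_of_pos_left 𝔓.small₁ 𝔓.β_pos
  have hβ := 𝔓.β_pos.ne'
  have h1 : 𝔓.β * (𝔉.kg * 𝔉.εT * 𝔓.L + 𝔓.τp / 𝔓.β * 𝔓.L₂) = 𝔓.β * 𝔉.kg * 𝔉.εT * 𝔓.L + 𝔓.τp * 𝔓.L₂ := by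
    field_simp
  have h2 : 𝔓.β * (𝔉.kg * (𝔉.κT / 𝔉.η₂) * 𝔉.ν ^ 2) = 𝔓.β * 𝔉.kg * (𝔉.κT / 𝔉.η₂) * 𝔉.ν ^ 2 := by ring
  rw [h1, h2] at h
  exact h

/-! ### The critical points of `F_H` in a zone -/

/-- At a point of `H₂₃` in the zone, `B - A = ν²` in Milnor's coordinates. [folklore] -/
theorem qB_sub_qA_eq {x : X} (hx : x ∈ 𝔓.zone j) (hH : x ∈ T.H₂₃) :
    BeltModel.qB ((𝔉.boxes.box j).coord x) - BeltModel.qA ((𝔉.boxes.box j).coord x) = 𝔉.ν ^ 2 := by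
  have hfc := 𝔓.f_eq_c_of_mem_H₂₃_of_mem_zone hH (𝔓.not_mem_X₁_of_mem_zone hx) hx
  have h := 𝔉.boxes.apply_eq hx.1
  rw [𝔉.A_eq_qA, 𝔉.B_eq_qB, hfc, 𝔉.c_eq] at h
  linarith

include hc2 in
/-- **The critical points of `F_H` in a zone** are the points with Milnor coordinates
`u₀ = u₁ = u₃ = 0` (Lagrange's condition on the lid `{B - A = ν²}` for the belt function:
`BeltModel.critical_iff`). [cite: GayKirby2016, §4, Lemma 14] -/
theorem isMCriticalPt_FH_iff_of_mem_zone {p : T.H₂₃} (hpz : p.1 ∈ 𝔓.zone j) :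
    letI := (T.bsliceAtlas hc2 𝔉.two_mul_ε_le 𝔉.linkCondition).chartedSpace
    IsMCriticalPt (𝓡∂ 3) 𝔓.FH p ↔
      (𝔉.boxes.box j).coord p.1 0 = 0 ∧ (𝔉.boxes.box j).coord p.1 1 = 0 ∧ (𝔉.boxes.box j).coord p.1 3 = 0 := by
  letI := (T.bsliceAtlas hc2 𝔉.two_mul_ε_le 𝔉.linkCondition).chartedSpace
  set Φ := T.bsliceAtlas hc2 𝔉.two_mul_ε_le 𝔉.linkCondition with hΦ
  set e := (𝔉.boxes.box j).chart with hedef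
  set zc := e (𝔉.boxes.cpt j) with hzc
  set u := (𝔉.boxes.box j).coord p.1 with hudef
  have hpe : p.1 ∈ e.source := hpz.1
  have he : e ∈ IsManifold.maximalAtlas (𝓡 4) ∞ X := (𝔉.boxes.box j).mem_maximalAtlas
  have hp₁ := 𝔓.not_mem_X₁_of_mem_zone hpz
  have hfc : B.f p.1 = T.c := 𝔓.f_eq_c_of_mem_H₂₃_of_mem_zone p.2 hp₁ hpz
  have hpc : ¬ IsMCriticalPt (𝓡 4) B.f p.1 := T.regular_c _ hfc
  have hS : ∀ q ∈ 𝔓.zone j, q ∈ T.H₂₃ ↔ B.f q = B.f p.1 := fun q hq => by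
    rw [hfc]; exact 𝔓.mem_H₂₃_iff_of_mem_zone hc2 hq
  have hint : (𝓡∂ 3).IsInteriorPoint p := by
    rw [ModelWithCorners.isInteriorPoint_iff_not_isBoundaryPoint,
      T.isBoundaryPoint_iff_mem_surface hc2 𝔉.two_mul_ε_le 𝔉.linkCondition p]
    exact (𝔓.not_mem_surface_of_mem_zone hpz)
  have hF : ContMDiffAt (𝓡 4) 𝓘(ℝ, ℝ) 2 𝔓.Famb p.1 := (𝔓.contMDiffAt_Famb_of_mem_H₂₃ hc2 p.2).of_le (by norm_cast)
  rw [Φ.isMCriticalPt_comp_val_iff_of_localLevel B.U.contMDiff_f hpc (𝔓.isOpen_zone j) hpz hS hint hF he hpe]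
  have hu : u = e p.1 - zc := 𝔉.coord_eq_sub hpe
  have hQ : BeltModel.qB u - BeltModel.qA u = 𝔉.ν ^ 2 := 𝔓.qB_sub_qA_eq hpz p.2
  have hBgt : 𝔉.ν ^ 2 / 2 < BeltModel.qB (e p.1 - zc) := by
    rw [← hu]; have := 𝔉.ν_pos; nlinarith [BeltModel.qA_nonneg u]
  have hz : e p.1 ∈ e.target := e.map_source hpe
  have hzone : e.symm (e p.1) ∈ 𝔓.zone j := by rw [e.left_inv hpe]; exact hpz
  have hf' : ∀ v, fderiv ℝ (B.f ∘ e.symm) (e p.1) v = 2 * BeltModel.ydot u v - 2 * BeltModel.xdot u v := fun v => by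
    rw [𝔉.fderiv_f_symm_apply hz, ← hu]
  have hF' : ∀ v, fderiv ℝ (𝔓.Famb ∘ e.symm) (e p.1) v =
      BeltModel.dbelt (𝔓.β * 𝔉.kg) 𝔉.εT (𝔉.κT / 𝔉.η₂) 𝔓.τp 𝔓.rhoHat 𝔓.chi2 u v := fun v => by
    rw [𝔓.fderiv_Famb_symm_apply hz hzone hBgt, ← hu]
  simp only [hf', hF']
  exact BeltModel.critical_iff (mul_pos 𝔓.β_pos 𝔉.kg_pos) (div_pos 𝔉.κT_pos 𝔉.η₂_pos) 𝔓.τp_pos 𝔉.εT_nonneg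
    𝔉.ν_pos (fun A => (𝔓.rhoHat_add_mul_deriv_mem A).1) (fun A => (𝔓.rhoHat_add_mul_deriv_mem A).2)
    𝔓.abs_deriv_chi2_le' (by rw [𝔓.chi2_of_le 𝔓.r₂_pos.le]; exact one_ne_zero) 𝔓.belt_small hQ

include hc2 in
/-- **The Morse data of `F_H` at a critical point in a zone**: nondegenerate, of index `0` if
`u₂ > 0` and `1` if `u₂ < 0` (`u = coord_j p`; the tangent hyperplane of the lid is `{v₂ = 0}`
and the Hessian is `2 K k₁ ν² (v₀w₀ + v₁w₁) ± τ' ν⁻² v₃ w₃`). [cite: GayKirby2016, §4, Lemma 14] [cite: Milnor1963, §2] -/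
theorem nondegenerate_and_morseIndex_FH_of_mem_zone {p : T.H₂₃} (hpz : p.1 ∈ 𝔓.zone j)
    (hcrit : letI := (T.bsliceAtlas hc2 𝔉.two_mul_ε_le 𝔉.linkCondition).chartedSpace
      IsMCriticalPt (𝓡∂ 3) 𝔓.FH p) :
    letI := (T.bsliceAtlas hc2 𝔉.two_mul_ε_le 𝔉.linkCondition).chartedSpace
    (mhessian (𝓡∂ 3) 𝔓.FH p).Nondegenerate ∧
      morseIndex (𝓡∂ 3) 𝔓.FH p = if 0 < (𝔉.boxes.box j).coord p.1 2 then 0 else 1 := by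
  letI := (T.bsliceAtlas hc2 𝔉.two_mul_ε_le 𝔉.linkCondition).chartedSpace
  set Φ := T.bsliceAtlas hc2 𝔉.two_mul_ε_le 𝔉.linkCondition with hΦ
  obtain ⟨h0, h1, h3⟩ := (𝔓.isMCriticalPt_FH_iff_of_mem_zone hc2 hpz).1 hcrit
  set e := (𝔉.boxes.box j).chart with hedef
  set zc := e (𝔉.boxes.cpt j) with hzc
  set u := (𝔉.boxes.box j).coord p.1 with hudef
  have hpe : p.1 ∈ e.source := hpz.1
  have he : e ∈ IsManifold.maximalAtlas (𝓡 4) ∞ X := (𝔉.boxes.box j).mem_maximalAtlas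
  have he2 : e ∈ IsManifold.maximalAtlas (𝓡 4) 2 X := IsManifold.maximalAtlas_subset_of_le (by norm_cast) he
  have hp₁ := 𝔓.not_mem_X₁_of_mem_zone hpz
  have hfc : B.f p.1 = T.c := 𝔓.f_eq_c_of_mem_H₂₃_of_mem_zone p.2 hp₁ hpz
  have hpc : ¬ IsMCriticalPt (𝓡 4) B.f p.1 := T.regular_c _ hfc
  have hS : ∀ q ∈ 𝔓.zone j, q ∈ T.H₂₃ ↔ B.f q = B.f p.1 := fun q hq => by
    rw [hfc]; exact 𝔓.mem_H₂₃_iff_of_mem_zone hc2 hq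
  have hint : (𝓡∂ 3).IsInteriorPoint p := by
    rw [ModelWithCorners.isInteriorPoint_iff_not_isBoundaryPoint,
      T.isBoundaryPoint_iff_mem_surface hc2 𝔉.two_mul_ε_le 𝔉.linkCondition p]
    exact (𝔓.not_mem_surface_of_mem_zone hpz)
  have hF : ContMDiffAt (𝓡 4) 𝓘(ℝ, ℝ) 2 𝔓.Famb p.1 := (𝔓.contMDiffAt_Famb_of_mem_H₂₃ hc2 p.2).of_le (by norm_cast)
  have hu : u = e p.1 - zc := 𝔉.coord_eq_sub hpe
  have hQ : BeltModel.qB u - BeltModel.qA u = 𝔉.ν ^ 2 := 𝔓.qB_sub_qA_eq hpz p.2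
  have hA : BeltModel.qA u = 0 := by rw [BeltModel.qA_apply, h0, h1]; ring
  have hBu : BeltModel.qB u = u 2 ^ 2 := by rw [BeltModel.qB_apply, h3]; ring
  have hν := 𝔉.ν_pos
  have hu2sq : u 2 ^ 2 = 𝔉.ν ^ 2 := by rw [← hBu]; linarith
  have hu2ne : u 2 ≠ 0 := by intro h; rw [h] at hu2sq; nlinarith
  have hBne : BeltModel.qB u ≠ 0 := by rw [hBu]; exact pow_ne_zero 2 hu2ne
  have hBpos : 0 < BeltModel.qB u := lt_of_le_of_ne (BeltModel.qB_nonneg u) (Ne.symm hBne)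
  have hBgt : 𝔉.ν ^ 2 / 2 < BeltModel.qB (e p.1 - zc) := by rw [← hu, hBu, hu2sq]; nlinarith
  have hz : e p.1 ∈ e.target := e.map_source hpe
  have hzone : e.symm (e p.1) ∈ 𝔓.zone j := by rw [e.left_inv hpe]; exact hpz
  -- `F` is critical on `X` at `p`
  have hFcrit : IsMCriticalPt (𝓡 4) 𝔓.Famb p.1 := by
    rw [isMCriticalPt_iff_fderiv_comp_extend_symm_eq_zero hF he2 hpe]
    have h : fderiv ℝ (𝔓.Famb ∘ e.symm) (e p.1) = 0 := by
      ext v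
      rw [𝔓.fderiv_Famb_symm_apply hz hzone hBgt, ← hu, BeltModel.dbelt_eq_zero_of_coords h0 h1 h3 hBne v]
      rfl
    simpa [OpenPartialHomeomorph.extend_coe, OpenPartialHomeomorph.extend_coe_symm] using h
  rw [Φ.morseIndex_comp_val_eq_of_localLevel B.U.contMDiff_f hpc (𝔓.isOpen_zone j) hpz hS hint hF hFcrit he hpe,
    Φ.nondegenerate_mhessian_comp_val_iff_of_localLevel B.U.contMDiff_f hpc (𝔓.isOpen_zone j) hpz hS hint hF hFcrit he hpe]
  -- the tangent hyperplane `{v₂ = 0}` and the Hessian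
  have hV : ∀ v, v ∈ LinearMap.ker (fderiv ℝ (B.f ∘ e.symm) (e p.1) : EuclideanSpace ℝ (Fin 4) →ₗ[ℝ] ℝ) ↔ v 2 = 0 := by
    intro v
    rw [LinearMap.mem_ker]
    show fderiv ℝ (B.f ∘ e.symm) (e p.1) v = 0 ↔ v 2 = 0
    rw [𝔉.fderiv_f_symm_apply hz v, ← hu, BeltModel.ydot_apply, BeltModel.xdot_apply, h0, h1, h3]
    constructor
    · intro h
      have h' : u 2 * v 2 = 0 := by linarith
      exact (mul_eq_zero.1 h').resolve_left hu2ne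
    · intro h; rw [h]; ring
  have hBf : ∀ v w, hessianInChart (𝓡 4) e 𝔓.Famb p.1 v w =
      2 * (𝔓.β * 𝔉.kg) * (𝔉.κT / 𝔉.η₂) * u 2 ^ 2 * (v 0 * w 0 + v 1 * w 1)
        + 𝔓.τp * u 2 * (Real.sqrt (BeltModel.qB u))⁻¹ ^ 3 * (v 3 * w 3) := fun v w => by
    rw [RegularLevel.hessianInChart_apply_eq, hu]
    rw [hu] at h0 h1 h3
    exact 𝔓.fderiv_fderiv_Famb_symm_apply hz hzone hBgt h0 h1 h3 v w
  have hd : 0 < 2 * (𝔓.β * 𝔉.kg) * (𝔉.κT / 𝔉.η₂) * u 2 ^ 2 := by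
    have := mul_pos 𝔓.β_pos 𝔉.kg_pos
    have := div_pos 𝔉.κT_pos 𝔉.η₂_pos
    have : 0 < u 2 ^ 2 := by rw [hu2sq]; positivity
    positivity
  have hs : 0 < (Real.sqrt (BeltModel.qB u))⁻¹ ^ 3 := pow_pos (inv_pos.2 (Real.sqrt_pos.2 hBpos)) 3
  by_cases hpos : 0 < u 2
  · rw [if_pos hpos]
    exact BeltModel.nondegenerate_and_sigNeg_eq_zero_of_apply_eq hd
      (mul_pos (mul_pos 𝔓.τp_pos hpos) hs) hBf hV
  · rw [if_neg hpos]
    have hneg : u 2 < 0 := lt_of_le_of_ne (not_lt.1 hpos) hu2ne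
    exact BeltModel.nondegenerate_and_sigNeg_eq_one_of_apply_eq hd
      (mul_neg_of_neg_of_pos (mul_neg_of_pos_of_neg 𝔓.τp_pos hneg) hs) hBf hV

end Zone

section BeltPoints

variable {j : ι}

omit [T2Space X] [CompactSpace X] in
/-- **The belt points `q_j(±ν)` lie in the zone.** [cite: GayKirby2016, §4, Lemma 14] -/
theorem beltPt_mem_zone {s : ℝ} (hs : s ^ 2 = 𝔉.ν ^ 2) : 𝔉.beltPt j s ∈ 𝔓.zone j := by
  have hs' : s ^ 2 ≤ 𝔉.η₂ := by rw [hs]; linarith [𝔉.two_nu_sq_le, sq_nonneg 𝔉.ν]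
  refine ⟨𝔉.beltPt_mem_source hs', ?_, ?_⟩
  · rw [𝔉.A_eq_qA, 𝔉.coord_beltPt hs', BeltModel.qA_apply]
    have h0 : beltVec s 0 = 0 := by simp
    have h1 : beltVec s 1 = 0 := by simp
    rw [h0, h1]
    linarith [𝔓.r₀_pos, 𝔓.r₀_lt, 𝔓.r₁_lt]
  · rw [𝔉.f_beltPt hs', hs, 𝔉.c_eq, show B.a + 𝔉.η₂ + 𝔉.ν ^ 2 - (B.a + 𝔉.η₂ + 𝔉.ν ^ 2) = 0 by ring, abs_zero]
    exact 𝔓.m₁_pos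

include 𝔓 hc2 in
/-- **The belt points lie in `H₂₃`** (their height is `c`). [cite: GayKirby2016, §4, Lemma 14] -/
theorem beltPt_mem_H₂₃ {s : ℝ} (hs : s ^ 2 = 𝔉.ν ^ 2) : 𝔉.beltPt j s ∈ T.H₂₃ := by
  have hs' : s ^ 2 ≤ 𝔉.η₂ := by rw [hs]; linarith [𝔉.two_nu_sq_le, sq_nonneg 𝔉.ν]
  exact 𝔓.mem_H₂₃_of_mem_zone_of_f_eq hc2 (𝔓.beltPt_mem_zone hs) (by rw [𝔉.f_beltPt hs', hs, 𝔉.c_eq])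

include hc2 in
/-- **The critical points of `F_H` in the `j`-th zone are the two belt points `q_j(±ν)`.**
[cite: GayKirby2016, §4, Lemma 14] -/
theorem isMCriticalPt_FH_iff_eq_beltPt {p : T.H₂₃} (hpz : p.1 ∈ 𝔓.zone j) :
    letI := (T.bsliceAtlas hc2 𝔉.two_mul_ε_le 𝔉.linkCondition).chartedSpace
    IsMCriticalPt (𝓡∂ 3) 𝔓.FH p ↔ p.1 = 𝔉.beltPt j 𝔉.ν ∨ p.1 = 𝔉.beltPt j (-𝔉.ν) := by
  rw [𝔓.isMCriticalPt_FH_iff_of_mem_zone hc2 hpz]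
  set u := (𝔉.boxes.box j).coord p.1 with hudef
  have hQ : BeltModel.qB u - BeltModel.qA u = 𝔉.ν ^ 2 := 𝔓.qB_sub_qA_eq hpz p.2
  have hν := 𝔉.ν_pos
  have hνη : 𝔉.ν ^ 2 ≤ 𝔉.η₂ := by linarith [𝔉.two_nu_sq_le, sq_nonneg 𝔉.ν]
  have hrec : p.1 = (𝔉.boxes.box j).chart.symm ((𝔉.boxes.box j).chart (𝔉.boxes.cpt j) + u) := by
    have h := (𝔉.boxes.box j).symm_add_coord (J := 𝓡 4) hpz.1
    simpa using h.symm
  constructor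
  · rintro ⟨h0, h1, h3⟩
    have hu2 : u 2 ^ 2 = 𝔉.ν ^ 2 := by
      rw [BeltModel.qB_apply, BeltModel.qA_apply, h0, h1, h3] at hQ; nlinarith
    have hcases : u 2 = 𝔉.ν ∨ u 2 = -𝔉.ν := by
      have : (u 2 - 𝔉.ν) * (u 2 + 𝔉.ν) = 0 := by nlinarith
      rcases mul_eq_zero.1 this with h | h
      · exact Or.inl (by linarith)
      · exact Or.inr (by linarith)
    have hueq : ∀ s, u 2 = s → u = beltVec s := fun s h2 => by
      ext i
      fin_cases i <;> simp [h0, h1, h2, h3]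
    rcases hcases with h2 | h2
    · left; rw [hrec, hueq _ h2]; rfl
    · right; rw [hrec, hueq _ h2]; rfl
  · have key : ∀ s, s ^ 2 = 𝔉.ν ^ 2 → p.1 = 𝔉.beltPt j s → u 0 = 0 ∧ u 1 = 0 ∧ u 3 = 0 := fun s hs h => by
      have hc : u = beltVec s := by rw [hudef, h, 𝔉.coord_beltPt (by rw [hs]; exact hνη)]
      simp [hc]
    rintro (h | h)
    · exact key _ rfl h
    · exact key _ (by ring) h

omit [T2Space X] [CompactSpace X] in
/-- The two belt points are distinct. [folklore] -/
theorem beltPt_ne (j : ι) : 𝔉.beltPt j 𝔉.ν ≠ 𝔉.beltPt j (-𝔉.ν) := fun h => by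
  have hν := 𝔉.ν_pos
  have hνη : 𝔉.ν ^ 2 ≤ 𝔉.η₂ := by linarith [𝔉.two_nu_sq_le, sq_nonneg 𝔉.ν]
  have h1 := 𝔉.coord_beltPt (j := j) (s := 𝔉.ν) hνη
  have h2 := 𝔉.coord_beltPt (j := j) (s := -𝔉.ν) (by rw [neg_sq]; exact hνη)
  rw [h, h2] at h1
  have := congrArg (fun v : EuclideanSpace ℝ (Fin 4) => v 2) h1
  simp at this
  linarith

include hc2 in
/-- **The index of the belt point `q_j(ν)` is `0`, that of `q_j(-ν)` is `1`** (both nondegenerate). [cite: GayKirby2016, §4, Lemma 14] -/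
theorem morseIndex_FH_beltPt {s : ℝ} (hs : s = 𝔉.ν ∨ s = -𝔉.ν) (p : T.H₂₃) (hp : p.1 = 𝔉.beltPt j s) :
    letI := (T.bsliceAtlas hc2 𝔉.two_mul_ε_le 𝔉.linkCondition).chartedSpace
    IsMCriticalPt (𝓡∂ 3) 𝔓.FH p ∧ (mhessian (𝓡∂ 3) 𝔓.FH p).Nondegenerate ∧
      morseIndex (𝓡∂ 3) 𝔓.FH p = if s = 𝔉.ν then 0 else 1 := by
  have hν := 𝔉.ν_pos
  have hs2 : s ^ 2 = 𝔉.ν ^ 2 := by rcases hs with rfl | rfl <;> ring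
  have hνη : s ^ 2 ≤ 𝔉.η₂ := by rw [hs2]; linarith [𝔉.two_nu_sq_le, sq_nonneg 𝔉.ν]
  have hpz : p.1 ∈ 𝔓.zone j := by rw [hp]; exact 𝔓.beltPt_mem_zone hs2
  have hcrit := (𝔓.isMCriticalPt_FH_iff_eq_beltPt hc2 hpz).2 (by
    rcases hs with rfl | rfl
    · exact Or.inl hp
    · exact Or.inr hp)
  obtain ⟨hnd, hidx⟩ := 𝔓.nondegenerate_and_morseIndex_FH_of_mem_zone hc2 hpz hcrit
  refine ⟨hcrit, hnd, ?_⟩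
  rw [hidx, hp, 𝔉.coord_beltPt hνη]
  have h2 : beltVec s 2 = s := by simp
  rw [h2]
  rcases hs with rfl | rfl
  · rw [if_pos hν, if_pos rfl]
  · rw [if_neg (by linarith), if_neg (by linarith)]

end BeltPoints


end BeltParams

end TubeFrame

end TriData

end BiCollar

end Literature.Topology.FourManifolds

end
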